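import Literature.NumberTheory.PAdicHodge.FontaineDpst
import Literature.NumberTheory.PAdicHodge.BdRDataNonempty
import Literature.NumberTheory.GaloisRepresentations.LocalGaloisGroupProofs
import HarnessLib

/-!
# Crux `EmptyWeightCore` (stmt-Langlands-17008): the crystallinity hypothesis has a pin-twin that voids it

Negative lemma of the standing disprover (refuter-cdisprove-stmt-Langlands-17008-0) for the crux
`Summit.Langlands.Langlands.Theses.NonParallelVoid.EmptyWeightCore` (route `NonParallelVoid`, rank 2)
and for stub S1 `stub_pinnedCrystallineDetLocal` of its picked line `local_clause_cut`.

The crux's load-bearing hypothesis is `(fontainePstAdicCompletion v p hv).IsCrystallineFramed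
(ρ.toLocal v)` at the two places `v ∣ p`: the determinant-parity line reads `det ρ|_{I_v}` off it
(clause (F12) of the pin, under `FontaineDatumExists`), and any REFUTATION of the crux would have to
ESTABLISH it for a ramified rank-2 `ρ.toLocal v` (regular Hodge–Tate weights force ramification).
The pin `fontainePst F p hp` is Hilbert's `ε` over the data on Fontaine's `B_dR(F)` with the canonical
`ℚ_p`-structure (`FontaineDpst`); unconditionally the tree knows exactly two things about it:
`fontainePst_algebra_eq_padicAlgebra` and `fontainePst_𝔅_eq_bdRPeriodRingData`.  This file shows
that these two invariants do NOT decide crystallinity of any ramified representation of rank `≥ 2`: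

* `exists_bdRDatum_isCrystallineFramed_imp_isLocallyUnramified` — for every `ℚ_p`-structure there is
  a datum ON `bdRPeriodRingData hp` (all five structure axioms proved) for which, in every rank
  `n ≥ 2`, `IsCrystallineFramed ρ → ρ.IsLocallyUnramified`.  Witness: the naive Weil–Deligne relation
  on unramified `ρ` (`(ρ|_{W_F}, N = 0)`, as in the accepted `nonempty_pstWeilDeligneData_bdR`) and,
  on RAMIFIED `ρ`, the Steinberg-type Weil–Deligne representation `spWD = (diag(q^{deg}, 1, …, 1), E₀₁)`
  (Tate, Corvallis (4.1.4)), which is unramified on `W_F` but has `N ≠ 0`, so that no `r ≅ spWD` has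
  `N = 0`;
* `exists_twin_fontainePst_isCrystallineFramed_imp_isLocallyUnramified`,
  `exists_twin_fontainePstAdicCompletion_isCrystallineFramed_imp_isLocallyUnramified` — hence a TWIN
  of THE pinned datum (same `algebra`, `HEq` period ring) with that property, over any `p`-adic field
  and at any place `v ∣ p` of a number field (the term of the crux).

Consequences recorded in the crux work file `Cruxes/EmptyWeightCore/Disproof.lean`: (i) `¬EmptyWeightCore`
is not provable by any argument uniform over the `ε`-range of the pin — the crux is unrefutable as typed
short of new unconditional facts about `fontainePst`'s Weil–Deligne half; (ii) dually, the accepted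
witness of `nonempty_pstWeilDeligneData_bdR` declares EVERY de Rham `ρ` crystalline, so S1 (whose
conclusion fails for de Rham `ρ` with a finite ramified twist in the determinant) is not to be had
uniformly over the `ε`-range either: the line closes exactly modulo `FontaineDatumExists`, as its lead
states.
No statement of the route is asserted here; no new definitions of mathematical content beyond the
explicit Steinberg-type Weil–Deligne representation.

## References
* [TateCorvallis1979] J. Tate, *Number theoretic background*, Corvallis 1979, (4.1.2)–(4.1.4).
* [FontaineAsterisque223VIII] J.-M. Fontaine, Astérisque 223 (1994), Exp. VIII §1.3, §2.3.7.
-/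

set_option linter.dupNamespace false -- project-wide option (lakefile weak.linter.dupNamespace); `Summit.Langlands.Langlands` is the mandated namespace

noncomputable section

open Field ValuativeRel
open scoped MatrixGroups

namespace Summit.Langlands.Langlands.Theorems.EmptyWeightCore.Negative

open Literature.NumberTheory.GaloisRepresentations Literature.NumberTheory.PAdicHodge
open Literature.NumberTheory.GaloisRepresentations.IsNonarchimedeanLocalField

section Special

variable {F : Type} [Field F] [ValuativeRel F] [TopologicalSpace F] [IsNonarchimedeanLocalField F]
variable (C : Type) [Field C] (n : ℕ)

/-- Scale the `0`-th coordinate of `Fin n → C` by `c`. [folklore] -/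
def scale0 (c : C) : (Fin n → C) →ₗ[C] (Fin n → C) where
  toFun v i := if (i : ℕ) = 0 then c * v i else v i
  map_add' v w := by
    funext i
    simp only [Pi.add_apply]
    split_ifs <;> ring
  map_smul' a v := by
    funext i
    simp only [Pi.smul_apply, smul_eq_mul, RingHom.id_apply]
    split_ifs <;> ring

/-- Unfolding lemma for `scale0`. [folklore] -/
@[simp] theorem scale0_apply (c : C) (v : Fin n → C) (i : Fin n) :
    scale0 C n c v i = if (i : ℕ) = 0 then c * v i else v i := rfl

/-- `scale0 1 = id`. [folklore] -/
theorem scale0_one : scale0 C n 1 = LinearMap.id :=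
  LinearMap.ext fun v => funext fun i => by simp

/-- `scale0` is multiplicative. [folklore] -/
theorem scale0_mul (c d : C) : scale0 C n (c * d) = scale0 C n c ∘ₗ scale0 C n d :=
  LinearMap.ext fun v => funext fun i => by
    simp only [scale0_apply, LinearMap.coe_comp, Function.comp_apply]
    split_ifs <;> ring

/-- The "monodromy" `N`: coordinate `1` is sent to coordinate `0`, everything else to `0`
(`N = E₀₁`; the zero map when `n ≤ 1`). [folklore] -/
def spN : (Fin n → C) →ₗ[C] (Fin n → C) where
  toFun v i := if (i : ℕ) = 0 then (if h : 1 < n then v ⟨1, h⟩ else 0) else 0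
  map_add' v w := by
    funext i
    simp only [Pi.add_apply]
    split_ifs <;> simp
  map_smul' a v := by
    funext i
    simp only [Pi.smul_apply, smul_eq_mul, RingHom.id_apply]
    split_ifs <;> simp

/-- Unfolding lemma for `spN`. [folklore] -/
@[simp] theorem spN_apply (v : Fin n → C) (i : Fin n) :
    spN C n v i = if (i : ℕ) = 0 then (if h : 1 < n then v ⟨1, h⟩ else 0) else 0 := rfl

/-- `N² = 0`. [folklore] -/
theorem spN_comp_spN : spN C n ∘ₗ spN C n = 0 :=
  LinearMap.ext fun v => funext fun i => by
    simp [spN_apply]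

/-- `N ≠ 0` in rank `≥ 2` (it sends `e₁` to `e₀`). [folklore] -/
theorem spN_ne_zero (hn : 2 ≤ n) : spN C n ≠ 0 := by
  intro h
  have h1 : 1 < n := by omega
  have h0 : 0 < n := by omega
  have := congrArg (fun f : (Fin n → C) →ₗ[C] (Fin n → C) =>
    f (fun j => if (j : ℕ) = 1 then (1 : C) else 0) ⟨0, h0⟩) h
  simp [spN_apply, h1] at this

variable [CharZero C]

variable (F) in
/-- The Steinberg-type ("special") representation of `W_F` on `Fin n → C`:
`w ↦ diag(q^{deg w}, 1, …, 1)`. [cite: TateCorvallis1979, (4.1.4)] -/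
def spRep : Representation C (WeilGroup F) (Fin n → C) where
  toFun w := scale0 C n ((residueFieldCard F : C) ^ (WeilGroup.deg w))
  map_one' := by
    rw [WeilGroup.deg_one IsFrobPow.mul_holds IsFrobPow.unique_holds, zpow_zero, scale0_one]
    rfl
  map_mul' w w' := by
    rw [WeilGroup.deg_mul IsFrobPow.mul_holds IsFrobPow.unique_holds,
      zpow_add₀ (by exact_mod_cast residueFieldCard_ne_zero F), scale0_mul]
    rfl

/-- Unfolding lemma for `spRep`. [cite: TateCorvallis1979, (4.1.4)] -/
@[simp] theorem spRep_apply (w : WeilGroup F) :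
    spRep F C n w = scale0 C n ((residueFieldCard F : C) ^ (WeilGroup.deg w)) := rfl

/-- The Steinberg-type representation of `W_F` is unramified (`deg = 0` on `I_F`).
[cite: TateCorvallis1979, (4.1.4)] -/
theorem spRep_isUnramified : WeilGroup.IsUnramifiedRep (spRep F C n) := by
  intro u hu
  rw [spRep_apply, (WeilGroup.deg_eq_zero_iff_mem_inertia IsFrobPow.mul_holds
    IsFrobPow.unique_holds).2 hu, zpow_zero, scale0_one]
  rfl

variable (F) in
/-- The Steinberg-type Weil–Deligne representation `(diag(q^{deg}, 1, …, 1), N = E₀₁)`: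
UNRAMIFIED on `W_F` but with `N ≠ 0` as soon as `n ≥ 2`. [cite: TateCorvallis1979, (4.1.4)] -/
def spWD : WeilDeligneRep F C (Fin n → C) where
  ρ := spRep F C n
  isContinuous := (spRep_isUnramified C n).isContinuousRep
  N := spN C n
  isNilpotent_N := ⟨2, by rw [pow_two, Module.End.mul_eq_comp, spN_comp_spN]⟩
  conj_N w := LinearMap.ext fun v => funext fun i => by
    simp only [spRep_apply, LinearMap.coe_comp, Function.comp_apply, scale0_apply, spN_apply,
      LinearMap.smul_apply, Pi.smul_apply, smul_eq_mul, one_ne_zero, ↓reduceIte]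
    split_ifs <;> simp

/-- The monodromy of `spWD` is `spN`. [folklore] -/
@[simp] theorem spWD_N : (spWD F C n).N = spN C n := rfl

/-- A Weil–Deligne representation with `N = 0` is not isomorphic to the Steinberg-type one in rank
`≥ 2`. [folklore] -/
theorem not_isEquivalent_spWD_of_N_eq_zero (hn : 2 ≤ n) {V : Type} [AddCommGroup V] [Module C V]
    {r : WeilDeligneRep F C V} (hN : r.N = 0) : ¬ r.IsEquivalent (spWD F C n) := by
  rintro ⟨e⟩
  apply spN_ne_zero C n hn
  have h := e.symm.comm_N
  rw [hN, LinearMap.zero_comp, spWD_N] at h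
  refine LinearMap.ext fun v => ?_
  have hv := congrArg (fun f => f v) h
  simp only [LinearMap.coe_comp, Function.comp_apply, LinearMap.zero_apply] at hv
  have hinj : Function.Injective e.symm.toLinearEquiv := e.symm.toLinearEquiv.injective
  rw [LinearMap.zero_apply]
  apply hinj
  rw [map_zero]
  exact hv

end Special

/-! ## The datum -/

variable {F : Type} [Field F] [ValuativeRel F] [TopologicalSpace F] [IsNonarchimedeanLocalField F]
  {p : ℕ} [Fact p.Prime]
variable [CharZero F] [Fact (¬ IsUnit (p : integerC F))]
  [IsAdicComplete (Ideal.span {(p : integerC F)}) (integerC F)] [Algebra ℚ_[p] F]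

set_option maxSynthPendingDepth 3 in
/-- **A pin-candidate datum on `B_dR(F)` with no ramified crystalline representation of rank `≥ 2`.**
There is a `p`-adic Hodge datum `𝔇` with the GIVEN `ℚ_p`-structure and period ring Fontaine's
`B_dR(F)` (`bdRPeriodRingData hp`) — i.e. in the subtype over which Hilbert's `ε` of the pin
`fontainePst` ranges — whose five structure axioms hold and for which, in every rank `n ≥ 2`,
`𝔇`-crystalline representations are unramified.  Witness: unramified `ρ ↦ (ρ|_{W_F}, 0)` (as in
`nonempty_pstWeilDeligneData_bdR`), RAMIFIED `ρ ↦` the Steinberg-type `(diag(q^{deg},1,…,1), E₀₁)`,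
which has `N ≠ 0`. [folklore] -/
theorem exists_bdRDatum_isCrystallineFramed_imp_isLocallyUnramified (hp : valuation F p < 1) :
    ∃ 𝔇 : PstWeilDeligneData F p, 𝔇.algebra = ‹Algebra ℚ_[p] F› ∧
      𝔇.𝔅 = (letI := 𝔇.algebra; bdRPeriodRingData (F := F) (p := p) hp) ∧
      ∀ {n : ℕ}, 2 ≤ n → ∀ ρ : FramedRep (absoluteGaloisGroup F) (PadicAlgCl p) n,
        𝔇.IsCrystallineFramed ρ → ρ.IsLocallyUnramified := by
  -- the Weil–Deligne relation: naive on unramified `ρ`, Steinberg-type on ramified `ρ`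
  let R : ∀ {n : ℕ}, FramedRep (absoluteGaloisGroup F) (PadicAlgCl p) n →
      WeilDeligneRep F (PadicAlgCl p) (Fin n → PadicAlgCl p) → Prop := fun {n} ρ r =>
    (ρ.IsLocallyUnramified ∧ r.N = 0 ∧ Nonempty (Representation.Equiv r.ρ (ρ.weilRestrict F))) ∨
      (¬ ρ.IsLocallyUnramified ∧ r.IsEquivalent (spWD F (PadicAlgCl p) n))
  let 𝔇 : PstWeilDeligneData F p :=
    { algebra := ‹Algebra ℚ_[p] F›
      𝔅 := bdRPeriodRingData (F := F) (p := p) hp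
      IsWeilDeligneOf := R
      exists_of_isDeRham := by
        intro n ρ _
        by_cases hu : ρ.IsLocallyUnramified
        · exact ⟨WeilDeligneRep.ofRep (ρ.weilRestrict F) hu.isUnramifiedRep_weilRestrict.isContinuousRep,
            Or.inl ⟨hu, rfl, ⟨Representation.Equiv.refl _⟩⟩⟩
        · exact ⟨spWD F (PadicAlgCl p) n, Or.inr ⟨hu, WeilDeligneRep.IsEquivalent.refl _⟩⟩
      isEquivalent := by
        intro n ρ r r' h h'
        rcases h with ⟨hu, hN, ⟨e⟩⟩ | ⟨hu, he⟩
        · rcases h' with ⟨_, hN', ⟨e'⟩⟩ | ⟨hu', _⟩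
          · exact ⟨{ toRepEquiv := e.trans e'.symm
                     comm_N := by rw [hN, hN', LinearMap.comp_zero, LinearMap.zero_comp] }⟩
          · exact absurd hu hu'
        · rcases h' with ⟨hu', _, _⟩ | ⟨_, he'⟩
          · exact absurd hu' hu
          · exact he.trans he'.symm
      conj := by
        intro n g ρ r h
        rcases h with ⟨hu, hN, ⟨e⟩⟩ | ⟨hu, he⟩
        · exact Or.inl ⟨(FramedRep.isLocallyUnramified_conj_iff g ρ).2 hu, hN,
            ⟨e.trans (FramedRep.weilRestrictConjEquiv g ρ)⟩⟩
        · exact Or.inr ⟨fun h => hu ((FramedRep.isLocallyUnramified_conj_iff g ρ).1 h), he⟩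
      isDeRhamWith_of_isLocallyUnramified := fun ρ h =>
        ρ.isDeRhamWith_bdR_of_isLocallyUnramified hp h
      wd_of_isLocallyUnramified := by
        intro n ρ r hρ h
        rcases h with ⟨_, hN, ⟨e⟩⟩ | ⟨hu, _⟩
        · refine ⟨hN, fun u hu => LinearMap.ext fun v => ?_⟩
          have h1 := Representation.IntertwiningMap.isIntertwining _ _ e.toIntertwiningMap u v
          rw [hρ.isUnramifiedRep_weilRestrict u hu] at h1
          exact e.injective h1
        · exact absurd hρ hu }
  refine ⟨𝔇, rfl, rfl, fun {n} hn ρ hρ => ?_⟩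
  obtain ⟨_, r, hr, hN, _⟩ := hρ
  rcases hr with ⟨hu, _, _⟩ | ⟨_, he⟩
  · exact hu
  · exact absurd he (not_isEquivalent_spWD_of_N_eq_zero (PadicAlgCl p) n hn hN)


/-! ## Twins of THE pinned datum -/

section Pin

omit [Fact (¬ IsUnit (p : integerC F))] [IsAdicComplete (Ideal.span {(p : integerC F)}) (integerC F)]
  [Algebra ℚ_[p] F] in
/-- **A twin of THE pinned datum `fontainePst F p hp` with no ramified crystalline representation of
rank `≥ 2`.**  There is a datum with the SAME `ℚ_p`-structure and the SAME period ring as the pin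
(the two invariants of `fontainePst` the tree knows unconditionally:
`fontainePst_algebra_eq_padicAlgebra`, `fontainePst_𝔅_eq_bdRPeriodRingData`; `HEq` because the type
of `𝔅` mentions the `algebra` field) for which
`IsCrystallineFramed ρ → ρ.IsLocallyUnramified` in every rank `n ≥ 2`.  Hence NO argument that is
uniform over Hilbert's `ε`-range can certify `(fontainePst F p hp).IsCrystallineFramed ρ` for a
ramified `ρ` of rank `≥ 2` — the crystallinity hypothesis of crux `EmptyWeightCore` at `v ∣ p` is
uncertifiable without `FontaineDatumExists` (and a refutation of the crux would need exactly that).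
[folklore] -/
theorem exists_twin_fontainePst_isCrystallineFramed_imp_isLocallyUnramified
    (hp : valuation F p < 1) :
    ∃ 𝔇 : PstWeilDeligneData F p, 𝔇.algebra = (fontainePst F p hp).algebra ∧
      HEq 𝔇.𝔅 (fontainePst F p hp).𝔅 ∧
      ∀ {n : ℕ}, 2 ≤ n → ∀ ρ : FramedRep (absoluteGaloisGroup F) (PadicAlgCl p) n,
        𝔇.IsCrystallineFramed ρ → ρ.IsLocallyUnramified := by
  letI := LocalField.padicAlgebra F p hp
  haveI : Fact (¬ IsUnit ((p : ℕ) : integerC F)) := ⟨not_isUnit_natCast_integerC hp⟩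
  haveI : IsAdicComplete (Ideal.span {((p : ℕ) : integerC F)}) (integerC F) :=
    isAdicComplete_integerC_natCast hp
  obtain ⟨𝔇, halg, h𝔅, h⟩ := exists_bdRDatum_isCrystallineFramed_imp_isLocallyUnramified (F := F) hp
  have halg' : 𝔇.algebra = (fontainePst F p hp).algebra :=
    halg.trans (fontainePst_algebra_eq_padicAlgebra hp).symm
  refine ⟨𝔇, halg', ?_, h⟩
  rw [h𝔅, fontainePst_𝔅_eq_bdRPeriodRingData hp]
  exact congr_arg_heq
    (fun a : Algebra ℚ_[p] F => (letI := a; bdRPeriodRingData (F := F) (p := p) hp)) halg'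

variable {K : Type} [Field K] [NumberField K]

open IsDedekindDomain NumberField in
/-- **The same at a place `v ∣ p` of a number field, for the summit's datum
`fontainePstAdicCompletion v p hv`** — the term in the hypotheses `IsCrystallineFramed (ρ.toLocal v)`
of crux `EmptyWeightCore` (`NonParallelVoid`, stmt-Langlands-17008): a twin datum with the pin's
`ℚ_p`-structure and period ring declares no ramified rank-`≥ 2` representation of `Γ_{K_v}`
crystalline. [folklore] -/
theorem exists_twin_fontainePstAdicCompletion_isCrystallineFramed_imp_isLocallyUnramified
    (v : HeightOneSpectrum (𝓞 K)) (p : ℕ) [Fact p.Prime] (hv : ((p : ℕ) : 𝓞 K) ∈ v.asIdeal) :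
    ∃ 𝔇 : PstWeilDeligneData (v.adicCompletion K) p,
      𝔇.algebra = (fontainePstAdicCompletion v p hv).algebra ∧
      HEq 𝔇.𝔅 (fontainePstAdicCompletion v p hv).𝔅 ∧
      ∀ {n : ℕ}, 2 ≤ n →
        ∀ ρ : FramedRep (absoluteGaloisGroup (v.adicCompletion K)) (PadicAlgCl p) n,
          𝔇.IsCrystallineFramed ρ → ρ.IsLocallyUnramified := by
  haveI := LocalField.charZero_adicCompletion v
  exact exists_twin_fontainePst_isCrystallineFramed_imp_isLocallyUnramified
    (LocalField.valuation_adicCompletion_natCast_lt_one v p hv)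

end Pin

end Summit.Langlands.Langlands.Theorems.EmptyWeightCore.Negative

end
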